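import Summits.BirchSwinnertonDyer.Rank1Residual.Additive.LegendreTwistMinusRelationOfCharTwist
import Summits.BirchSwinnertonDyer.Rank1Residual.Additive.LegendreTwistRelationOfCurveTwist
import Summits.BirchSwinnertonDyer.Rank1Residual.Additive.SemistableTwistAnalyticOdd
import Literature.NumberTheory.EllipticCurves.PAdicLFunctionMinusDenominatorsProofs
import Literature.NumberTheory.EllipticCurves.ModularSymbolsManinDrinfeldGeneralProofs
import HarnessLib

/-!
# Class N10, defect 2: the tame branch of an additive curve EXISTS UNCONDITIONALLY on (M) and
# (G-ord, `e = 2`) at `p ≡ 3 (mod 4)` — hence at EVERY odd `p`, in particular `p = 3` — and the JOIN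
# with the typed main conjecture (cell `b2b-bsdres`, lane CLASS-CLOSURE, seat cc-typer-2 GEN 4;
# odd twin of GEN 3's `LegendreTwistRelationOfCurveTwist.lean`; curve-level corollaries of
# `LegendreTwistMinusRelationOfCharTwist.lean` + `TameBranchOfSemistableTwistJoin.lean` §6 +
# `Literature/…/PAdicLFunctionMinusDenominatorsProofs.lean`)

HONEST FRAMING (cell `b2b-bsdres`, run/shared/lean/b2b/bsd-rank1-residual/, verbatim in every
file): the goal of the cell is to DELETE the COMBINATION-SHAPED residual classes of the
Birch–Swinnerton-Dyer formula for ALL analytic-rank `≤ 1` elliptic curves over `ℚ` — "full BSD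
formula for every rank `≤ 1` curve in class `C`" assembled STRICTLY from published theorems — so
that the rank-`≤ 1` remainder becomes exactly the CONSTRUCTION-SHAPED classes, which are TYPED
(missing-input `Prop`s), NOT attempted. This is not "finishing BSD". Lane CLASS-CLOSURE
(coordinator ruling 2026-08-21T04:07Z): research routes, no claim beyond the stated classes;
census output = EVIDENCE / conjecture items with held-out validation, NEVER a Literature fact;
the class N10 stays CONSTRUCTION-shaped (RESIDUAL-MAP §I); NOTHING is booked. THEOREMS ONLY; no
definition, no named fact, no conjecture node; labels / RESIDUAL-MAP marks UNCHANGED.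

## What and why

Let `E = W` be additive at a prime `p ≡ 3 (mod 4)` and `ℚ`-isomorphic to the twist by `p* = −p` of a
curve `V = E♭` (`C • V^{(−p)} = W`), with newforms `f = f_E`, `g = f_{E♭}`.
1. (§1, `exists_legendreTwistMinusRel_of_twist`) `aₙ(f) = (n/p)·aₙ(g)` (tree
   `intCast_LFunction_eq_jacobiChar_mul_cuspCoeff_of_neg`), so the PROVED odd-branch relation
   `exists_legendreTwistMinusRel_of_cuspCoeff_eq` gives `∃ c ∈ ℚ, [s]⁺_f = c·∑_u (u/p)[s + u/p]⁻_g`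
   (`LegendreTwistMinusRel p f g c`).
2. (§2) with the minus-symbol common denominator now a THEOREM for EVERY cusp form
   (`exists_forall_ratMinusSymbol_eq_div_of_maninDrinfeld` + the tree's general Manin–Drinfeld
   `exists_nsmul_modularSymbol_mem_periodLattice_holds`), BOTH binders of
   `TameBranchOfSemistableTwistJoin.lean` §6 are discharged: the E-normalised tame branch
   `IsTameBranchOf f p (ι∘χ_p) α B` EXISTS (and is unique) at `p ≡ 3 (mod 4)` with `α = unitRoot V p`
   on (G-ord, `e = 2`) and `α = a_p(V) = ±1` on (M).
3. (§3) EVERY ODD `p`: with the twist written as `V^{(p*)}`, `p* = (−1)^{(p−1)/2} p`, dispatch on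
   `p mod 4` (tree `KramerLocal.mod_four_eq_one_or_three`, inlined) to GEN 3's even-branch theorems / §2 — `exists[Unique]_isTameBranchOf_of_goodOrd_twist_pStar`,
   `…_of_mult_twist_pStar` (`p ≠ 2` the only congruence hypothesis).
4. (§4, JOIN) feeding `B` to the typed RATIONAL tame-branch main conjecture `TameBranchRatCharEqAt W p`
   (`TameBranchLower.lean`; the N10 missing input, NOT in print; an explicit binder): every Selmer dual
   datum of `E` over the cyclotomic `ℤ_p`-extension is `Λ`-torsion with characteristic power series
   `p^k·B(T)` — on (M) with no further hypothesis, on (G-ord) given the `W`-side typing.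
So on the WHOLE defect-2 part of N10 (cells (M) and (G-ord, `e = 2`), every odd `p`; S-b: (M) 97 585 +
GordTwo 10 336 of the 111 994 N10 cells, `class-closure/N10/STATEMENT.md`) the ONLY non-theorem input of
the Λ-level statement is `TameBranchRatCharEqAt` itself. Nothing booked; marks unchanged.

References: Mazur–Tate–Teitelbaum, Invent. Math. 84 (1986) §I.8, §I.10–§I.11
[MazurTateTeitelbaum1986Invent]; Shimura 1971 Prop. 3.64 [Shimura1971]; Manin 1972 Cor. 3.6
[Manin1972]; Silverman AEC VII.5.1(b), C.16 [SilvermanAEC2009].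
-/

noncomputable section

open scoped Classical MatrixGroups ModularForm

open CongruenceSubgroup

namespace Summit.BirchSwinnertonDyer.Rank1Residual.Additive

open Literature.NumberTheory.EllipticCurves Literature.NumberTheory.EllipticCurves.ModularForms
  Literature.NumberTheory.EllipticCurves.Rank1Residual Literature.NumberTheory.QuadraticFields
  WeierstrassCurve

/-! ### §1 The `q`-expansion twist and the odd-branch relation at curve level (`p ≡ 3 (mod 4)`) -/

section QExp

variable {p : ℕ} [hp : Fact p.Prime] {N N' : ℕ} [NeZero N] [NeZero N']
  {f : CuspForm (Gamma0 N) 2} {g : CuspForm (Gamma0 N') 2}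

/-- **`aₙ(f_E) = (n/p)·aₙ(f_{E♭})`** for `E = W ≅ V ⊗ χ_{−p}` additive at `p ≡ 3 (mod 4)` (so
`p* = −p`), `f` the newform of `W`, `g` the newform of `V` (tree
`intCast_LFunction_eq_jacobiChar_mul_cuspCoeff_of_neg`). [folklore] -/
theorem cuspCoeff_eq_legendreSym_mul_cuspCoeff_of_twist_neg (hp4 : p % 4 = 3)
    (V W : WeierstrassCurve ℚ) [V.IsElliptic] [W.IsElliptic]
    (hVW : ∃ C : VariableChange ℚ, C • V.quadraticTwist (-(p : ℚ)) = W) (hadd : Addv W p)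
    (hf : IsNewformOf W f) (hg : IsNewformOf V g) (n : ℕ) :
    cuspCoeff f n = (legendreSym p n : ℂ) * cuspCoeff g n := by
  haveI : NeZero p := ⟨hp.out.ne_zero⟩
  have h := intCast_LFunction_eq_jacobiChar_mul_cuspCoeff_of_neg p hp4 V W hVW hadd hg n
  rw [jacobiChar_natCast, ← jacobiSym.legendreSym.to_jacobiSym] at h
  rw [hf.2 n, h]

omit [NeZero N] [NeZero N'] in
/-- `p ≡ 3 (mod 4)` ⇒ `p ≠ 2` and `(−1/p) = −1` (Mathlib `legendreSym.at_neg_one`, `χ₄`). [folklore] -/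
theorem ne_two_and_legendreSym_neg_one_of_mod_four_eq_three (hp4 : p % 4 = 3) :
    p ≠ 2 ∧ legendreSym p (-1) = -1 := by
  have hp2 : p ≠ 2 := by omega
  exact ⟨hp2, by rw [legendreSym.at_neg_one hp2, ZMod.χ₄_nat_three_mod_four hp4]⟩

omit hp [NeZero N] [NeZero N'] in
/-- `p* = −p` as a rational number when `p ≡ 3 (mod 4)`. [folklore] -/
theorem intCast_pStar_eq_neg_of_mod_four_eq_three (hp4 : p % 4 = 3) :
    (((-1 : ℤ) ^ (p / 2) * p : ℤ) : ℚ) = -(p : ℚ) := by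
  rw [neg_one_pow_half_eq_neg_one_of_mod_four_eq_three p hp4]
  push_cast
  ring

omit hp [NeZero N] [NeZero N'] in
/-- `p* = p` as a rational number when `p ≡ 1 (mod 4)`. [folklore] -/
theorem intCast_pStar_eq_of_mod_four_eq_one (hp4 : p % 4 = 1) :
    (((-1 : ℤ) ^ (p / 2) * p : ℤ) : ℚ) = (p : ℚ) := by
  rw [neg_one_pow_half_eq_one_of_mod_four_eq_one p hp4]
  push_cast
  ring

/-- **The Legendre twist relation on the ODD branch for `(f_E, f_{E♭})`, PROVED** at `p ≡ 3 (mod 4)`: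
for `E = W ≅ V ⊗ χ_{−p}` additive at `p`, `f` the newform of `W` and `g` the newform of `V`, there is
`c ∈ ℚ` with `[s]⁺_f = c·∑_{u mod p}(u/p)[s + u/p]⁻_g` for all `s` — §1 and the odd-branch theorem
`exists_legendreTwistMinusRel_of_cuspCoeff_eq`. The comparison statement of
`TameBranchOfSemistableTwistJoin.lean` §6 is thereby discharged on this locus.
[cite: Shimura1971, Prop. 3.64] [cite: MazurTateTeitelbaum1986Invent, §I.8] -/
theorem exists_legendreTwistMinusRel_of_twist (hp4 : p % 4 = 3)
    (V W : WeierstrassCurve ℚ) [V.IsElliptic] [W.IsElliptic]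
    (hVW : ∃ C : VariableChange ℚ, C • V.quadraticTwist (-(p : ℚ)) = W) (hadd : Addv W p)
    (hf : IsNewformOf W f) (hg : IsNewformOf V g) :
    ∃ c : ℚ, LegendreTwistMinusRel p f g c := by
  obtain ⟨hp2, hodd⟩ := ne_two_and_legendreSym_neg_one_of_mod_four_eq_three (p := p) hp4
  exact exists_legendreTwistMinusRel_of_cuspCoeff_eq hp2 hodd hf.1 hf.coeffField_eq_bot hg.1
    hg.coeffField_eq_bot (cuspCoeff_eq_legendreSym_mul_cuspCoeff_of_twist_neg hp4 V W hVW hadd hf hg)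

/-- The same relation with `E♭` presented as the model `W^{(p*)}` (`p* = −p` here) and `g` its newform
(tree `cuspCoeff_eq_legendreSym_mul_cuspCoeff`). [cite: MazurTateTeitelbaum1986Invent, §I.8] -/
theorem exists_legendreTwistMinusRel_of_quadraticTwist_pStar (hp4 : p % 4 = 3)
    (W : WeierstrassCurve ℚ) [W.IsElliptic] (hadd : Addv W p) (hf : IsNewformOf W f)
    (hg : IsNewformOf (W.quadraticTwist (((-1 : ℤ) ^ (p / 2) * p : ℤ) : ℚ)) g) :
    ∃ c : ℚ, LegendreTwistMinusRel p f g c := by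
  obtain ⟨hp2, hodd⟩ := ne_two_and_legendreSym_neg_one_of_mod_four_eq_three (p := p) hp4
  exact exists_legendreTwistMinusRel_of_cuspCoeff_eq hp2 hodd hf.1 hf.coeffField_eq_bot hg.1
    hg.coeffField_eq_bot (W.cuspCoeff_eq_legendreSym_mul_cuspCoeff hp2
      (primesEquiv_symm_apply_coe p) (hasAdditiveReductionAt_of_addv W p hadd) hf hg)

omit hp [NeZero N] in
/-- **Manin–Drinfeld for `[·]⁻`, UNCONDITIONALLY**: for EVERY weight-2 cusp form `g` on `Γ₀(N')` there
is one common denominator for all `[r]⁻_g` (`exists_forall_ratMinusSymbol_eq_div_of_maninDrinfeld` with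
the tree's general Manin–Drinfeld theorem `exists_nsmul_modularSymbol_mem_periodLattice_holds`) — the
`hden` input of `TameBranchOfSemistableTwistJoin.lean` §6, discharged with no hypothesis.
[cite: Manin1972, Cor. 3.6] -/
theorem exists_forall_ratMinusSymbol_eq_div (g : CuspForm (Gamma0 N') 2) :
    ∃ D : ℕ, 0 < D ∧ ∀ r : ℚ, ∃ m : ℤ, ratMinusSymbol g r = (m : ℚ) / D :=
  exists_forall_ratMinusSymbol_eq_div_of_maninDrinfeld
    (exists_nsmul_modularSymbol_mem_periodLattice_holds g)

end QExp

/-! ### §2 The tame branch EXISTS (and is unique) on (G-ord, `e = 2`) and (M) at `p ≡ 3 (mod 4)` -/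

section Unconditional

variable {p : ℕ} [hp : Fact p.Prime] {N N' : ℕ} [NeZero N] [NeZero N']
  {f : CuspForm (Gamma0 N) 2} {g : CuspForm (Gamma0 N') 2}

/-- **(G-ord, `e = 2`) from `E♭`, UNCONDITIONAL at `p ≡ 3 (mod 4)`: the E-normalised tame branch of
`f_E` for `χ_p` and THE unit root `α = unitRoot E♭ p` exists.** `E = W ≅ V ⊗ χ_{−p}` additive at `p`,
`V` globally minimal GOOD ORDINARY at `p`, `f`, `g` the newforms of `W`, `V`: then
`∃ B, IsTameBranchOf f p (ι∘χ_p) (unitRoot V p) B`, with `‖b_n‖ ≤ C` for any bound `C` of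
`‖[·]⁺_f‖_p` — `exists_isTameBranchOf_legendreMinus_of_goodOrd` with BOTH its hypotheses (`hden`,
`hrel`) DISCHARGED. [cite: MazurTateTeitelbaum1986Invent, §I.10 (10.1)–(10.2) and §I.11] -/
theorem exists_isTameBranchOf_of_goodOrd_twist_neg (hp4 : p % 4 = 3)
    (V W : WeierstrassCurve ℚ) [V.IsElliptic] [V.IsGloballyMinimal] [W.IsElliptic]
    (hVW : ∃ C : VariableChange ℚ, C • V.quadraticTwist (-(p : ℚ)) = W) (hadd : Addv W p)
    (hord : GoodOrd V p) (hf : IsNewformOf W f) (hg : IsNewformOf V g) :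
    ∃ B : PowerSeries ℚ_[p],
      IsTameBranchOf f p ((legendreChar p).ringHomComp (algebraMap ℚ_[p] ℂ_[p]))
        (unitRoot V p : ℚ_[p]) B ∧
      ∀ C : ℝ, (∀ r : ℚ, ‖((ratPlusSymbol f r : ℚ) : ℚ_[p])‖ ≤ C) →
        ∀ n : ℕ, ‖PowerSeries.coeff n B‖ ≤ C := by
  have hp2 : p ≠ 2 := (ne_two_and_legendreSym_neg_one_of_mod_four_eq_three (p := p) hp4).1
  obtain ⟨c, hrel⟩ := exists_legendreTwistMinusRel_of_twist hp4 V W hVW hadd hf hg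
  obtain ⟨D, hD, hden⟩ := exists_forall_ratMinusSymbol_eq_div g
  exact exists_isTameBranchOf_legendreMinus_of_goodOrd V hp2 ((isOrdinaryAt_iff V p).mpr hord) hg hD
    hden hrel

/-- **(G-ord, `e = 2`), `p ≡ 3 (mod 4)`: `∃!`** (`IsTameBranchOf.unique`).
[cite: MazurTateTeitelbaum1986Invent, §I.11 and §I.14 (14.3)] -/
theorem existsUnique_isTameBranchOf_of_goodOrd_twist_neg (hp4 : p % 4 = 3)
    (V W : WeierstrassCurve ℚ) [V.IsElliptic] [V.IsGloballyMinimal] [W.IsElliptic]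
    (hVW : ∃ C : VariableChange ℚ, C • V.quadraticTwist (-(p : ℚ)) = W) (hadd : Addv W p)
    (hord : GoodOrd V p) (hf : IsNewformOf W f) (hg : IsNewformOf V g) :
    ∃! B : PowerSeries ℚ_[p],
      IsTameBranchOf f p ((legendreChar p).ringHomComp (algebraMap ℚ_[p] ℂ_[p]))
        (unitRoot V p : ℚ_[p]) B := by
  obtain ⟨B, hB, -⟩ := exists_isTameBranchOf_of_goodOrd_twist_neg hp4 V W hVW hadd hord hf hg
  exact ⟨B, hB, fun B' hB' ↦ hB'.unique hB⟩

/-- **(M) from `E♭`, UNCONDITIONAL at `p ≡ 3 (mod 4)`: the E-normalised tame branch of `f_E` for `χ_p`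
and `α = a_p(E♭) = ±1` exists.** `E = W ≅ V ⊗ χ_{−p}` additive at `p`, `V` MULTIPLICATIVE at `p`, `f`,
`g` the newforms of `W`, `V`: then `∃ B, IsTameBranchOf f p (ι∘χ_p) (a_p(V)) B` with the same
coefficient bound — `exists_isTameBranchOf_legendreMinus_of_mult` (`a_p(V) = ±1`, `p ∣ N'` by
`LFunction_eq_or_eq_neg_and_dvd_level_of_mult`) with BOTH its hypotheses DISCHARGED.
[cite: MazurTateTeitelbaum1986Invent, §I.10 (10.1) with ε(p) = 0] -/
theorem exists_isTameBranchOf_of_mult_twist_neg (hp4 : p % 4 = 3)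
    (V W : WeierstrassCurve ℚ) [V.IsElliptic] [W.IsElliptic]
    (hVW : ∃ C : VariableChange ℚ, C • V.quadraticTwist (-(p : ℚ)) = W) (hadd : Addv W p)
    (hV : Mult V p) (hf : IsNewformOf W f) (hg : IsNewformOf V g) :
    ∃ B : PowerSeries ℚ_[p],
      IsTameBranchOf f p ((legendreChar p).ringHomComp (algebraMap ℚ_[p] ℂ_[p]))
        (((V.LFunction p : ℤ)) : ℚ_[p]) B ∧
      ∀ C : ℝ, (∀ r : ℚ, ‖((ratPlusSymbol f r : ℚ) : ℚ_[p])‖ ≤ C) →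
        ∀ n : ℕ, ‖PowerSeries.coeff n B‖ ≤ C := by
  have hp2 : p ≠ 2 := (ne_two_and_legendreSym_neg_one_of_mod_four_eq_three (p := p) hp4).1
  obtain ⟨c, hrel⟩ := exists_legendreTwistMinusRel_of_twist hp4 V W hVW hadd hf hg
  obtain ⟨D, hD, hden⟩ := exists_forall_ratMinusSymbol_eq_div g
  obtain ⟨hap1, hpN⟩ := LFunction_eq_or_eq_neg_and_dvd_level_of_mult V hV hg
  exact exists_isTameBranchOf_legendreMinus_of_mult hp2 hg.1 hg.coeffField_eq_bot hpN (hg.2 p) hap1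
    hD hden hrel

/-- **(M), `p ≡ 3 (mod 4)`: `∃!`** (`IsTameBranchOf.unique`). [cite: MazurTateTeitelbaum1986Invent, §I.11 and §I.14 (14.3)] -/
theorem existsUnique_isTameBranchOf_of_mult_twist_neg (hp4 : p % 4 = 3)
    (V W : WeierstrassCurve ℚ) [V.IsElliptic] [W.IsElliptic]
    (hVW : ∃ C : VariableChange ℚ, C • V.quadraticTwist (-(p : ℚ)) = W) (hadd : Addv W p)
    (hV : Mult V p) (hf : IsNewformOf W f) (hg : IsNewformOf V g) :
    ∃! B : PowerSeries ℚ_[p],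
      IsTameBranchOf f p ((legendreChar p).ringHomComp (algebraMap ℚ_[p] ℂ_[p]))
        (((V.LFunction p : ℤ)) : ℚ_[p]) B := by
  obtain ⟨B, hB, -⟩ := exists_isTameBranchOf_of_mult_twist_neg hp4 V W hVW hadd hV hf hg
  exact ⟨B, hB, fun B' hB' ↦ hB'.unique hB⟩

end Unconditional

/-! ### §3 EVERY ODD `p`: the twist by `p* = (−1)^{(p−1)/2} p`, dispatch on `p mod 4` -/

section OddPrime

variable {p : ℕ} [hp : Fact p.Prime] {N N' : ℕ} [NeZero N] [NeZero N']
  {f : CuspForm (Gamma0 N) 2} {g : CuspForm (Gamma0 N') 2}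

/-- **(G-ord, `e = 2`) at EVERY odd `p`: the tame branch for `α = unitRoot E♭ p` EXISTS.**
`E = W ≅ V ⊗ χ_{p*}` (`C • V^{(p*)} = W`, `p* = (−1)^{(p−1)/2} p`) additive at `p ≠ 2`, `V` globally
minimal good ordinary at `p`, `f`, `g` the newforms of `W`, `V` — GEN 3's even-branch theorem at
`p ≡ 1 (mod 4)`, §2 at `p ≡ 3 (mod 4)`. No comparison or denominator hypothesis is left.
[cite: MazurTateTeitelbaum1986Invent, §I.10 (10.1)–(10.2) and §I.11] -/
theorem exists_isTameBranchOf_of_goodOrd_twist_pStar (hp2 : p ≠ 2)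
    (V W : WeierstrassCurve ℚ) [V.IsElliptic] [V.IsGloballyMinimal] [W.IsElliptic]
    (hVW : ∃ C : VariableChange ℚ, C • V.quadraticTwist ((((-1 : ℤ) ^ (p / 2) * p : ℤ)) : ℚ) = W)
    (hadd : Addv W p) (hord : GoodOrd V p) (hf : IsNewformOf W f) (hg : IsNewformOf V g) :
    ∃ B : PowerSeries ℚ_[p],
      IsTameBranchOf f p ((legendreChar p).ringHomComp (algebraMap ℚ_[p] ℂ_[p]))
        (unitRoot V p : ℚ_[p]) B ∧
      ∀ C : ℝ, (∀ r : ℚ, ‖((ratPlusSymbol f r : ℚ) : ℚ_[p])‖ ≤ C) →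
        ∀ n : ℕ, ‖PowerSeries.coeff n B‖ ≤ C := by
  have hodd : p % 2 = 1 := Nat.odd_iff.mp (hp.out.odd_of_ne_two hp2)
  rcases (show p % 4 = 1 ∨ p % 4 = 3 by omega) with h1 | h3
  · rw [intCast_pStar_eq_of_mod_four_eq_one (p := p) h1] at hVW
    exact exists_isTameBranchOf_of_goodOrd_twist h1 V W hVW hadd hord hf hg
  · rw [intCast_pStar_eq_neg_of_mod_four_eq_three (p := p) h3] at hVW
    exact exists_isTameBranchOf_of_goodOrd_twist_neg h3 V W hVW hadd hord hf hg

/-- **(G-ord, `e = 2`) at EVERY odd `p`: `∃!`.** [cite: MazurTateTeitelbaum1986Invent, §I.11 and §I.14 (14.3)] -/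
theorem existsUnique_isTameBranchOf_of_goodOrd_twist_pStar (hp2 : p ≠ 2)
    (V W : WeierstrassCurve ℚ) [V.IsElliptic] [V.IsGloballyMinimal] [W.IsElliptic]
    (hVW : ∃ C : VariableChange ℚ, C • V.quadraticTwist ((((-1 : ℤ) ^ (p / 2) * p : ℤ)) : ℚ) = W)
    (hadd : Addv W p) (hord : GoodOrd V p) (hf : IsNewformOf W f) (hg : IsNewformOf V g) :
    ∃! B : PowerSeries ℚ_[p],
      IsTameBranchOf f p ((legendreChar p).ringHomComp (algebraMap ℚ_[p] ℂ_[p]))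
        (unitRoot V p : ℚ_[p]) B := by
  obtain ⟨B, hB, -⟩ := exists_isTameBranchOf_of_goodOrd_twist_pStar hp2 V W hVW hadd hord hf hg
  exact ⟨B, hB, fun B' hB' ↦ hB'.unique hB⟩

/-- **(M) at EVERY odd `p`: the tame branch for `α = a_p(E♭) = ±1` EXISTS.** `E = W ≅ V ⊗ χ_{p*}`
additive at `p ≠ 2`, `V` multiplicative at `p`, `f`, `g` the newforms of `W`, `V`.
[cite: MazurTateTeitelbaum1986Invent, §I.10 (10.1) with ε(p) = 0] -/
theorem exists_isTameBranchOf_of_mult_twist_pStar (hp2 : p ≠ 2)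
    (V W : WeierstrassCurve ℚ) [V.IsElliptic] [W.IsElliptic]
    (hVW : ∃ C : VariableChange ℚ, C • V.quadraticTwist ((((-1 : ℤ) ^ (p / 2) * p : ℤ)) : ℚ) = W)
    (hadd : Addv W p) (hV : Mult V p) (hf : IsNewformOf W f) (hg : IsNewformOf V g) :
    ∃ B : PowerSeries ℚ_[p],
      IsTameBranchOf f p ((legendreChar p).ringHomComp (algebraMap ℚ_[p] ℂ_[p]))
        (((V.LFunction p : ℤ)) : ℚ_[p]) B ∧
      ∀ C : ℝ, (∀ r : ℚ, ‖((ratPlusSymbol f r : ℚ) : ℚ_[p])‖ ≤ C) →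
        ∀ n : ℕ, ‖PowerSeries.coeff n B‖ ≤ C := by
  have hodd : p % 2 = 1 := Nat.odd_iff.mp (hp.out.odd_of_ne_two hp2)
  rcases (show p % 4 = 1 ∨ p % 4 = 3 by omega) with h1 | h3
  · rw [intCast_pStar_eq_of_mod_four_eq_one (p := p) h1] at hVW
    exact exists_isTameBranchOf_of_mult_twist h1 V W hVW hadd hV hf hg
  · rw [intCast_pStar_eq_neg_of_mod_four_eq_three (p := p) h3] at hVW
    exact exists_isTameBranchOf_of_mult_twist_neg h3 V W hVW hadd hV hf hg

/-- **(M) at EVERY odd `p`: `∃!`.** [cite: MazurTateTeitelbaum1986Invent, §I.11 and §I.14 (14.3)] -/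
theorem existsUnique_isTameBranchOf_of_mult_twist_pStar (hp2 : p ≠ 2)
    (V W : WeierstrassCurve ℚ) [V.IsElliptic] [W.IsElliptic]
    (hVW : ∃ C : VariableChange ℚ, C • V.quadraticTwist ((((-1 : ℤ) ^ (p / 2) * p : ℤ)) : ℚ) = W)
    (hadd : Addv W p) (hV : Mult V p) (hf : IsNewformOf W f) (hg : IsNewformOf V g) :
    ∃! B : PowerSeries ℚ_[p],
      IsTameBranchOf f p ((legendreChar p).ringHomComp (algebraMap ℚ_[p] ℂ_[p]))
        (((V.LFunction p : ℤ)) : ℚ_[p]) B := by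
  obtain ⟨B, hB, -⟩ := exists_isTameBranchOf_of_mult_twist_pStar hp2 V W hVW hadd hV hf hg
  exact ⟨B, hB, fun B' hB' ↦ hB'.unique hB⟩

end OddPrime

/-! ### §4 JOIN at EVERY odd `p`: the ONLY non-theorem input of the Λ-level N10 statement is `TameBranchRatCharEqAt` -/

section Join

variable (W : WeierstrassCurve ℚ) [W.IsElliptic] [W.IsGloballyMinimal] (p : ℕ) [hp : Fact p.Prime]
  {N N' : ℕ} [NeZero N] [NeZero N'] {f : CuspForm (Gamma0 N) 2} {g : CuspForm (Gamma0 N') 2}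

/-- **JOIN on (M), every odd `p`.** For `E = W` globally minimal, additive at `p ≠ 2`, `ℚ`-isomorphic
to `V ⊗ χ_{p*}` with `V` multiplicative at `p`, newforms `f` of `W` and `g` of `V`: GIVEN the typed
rational tame-branch main conjecture `TameBranchRatCharEqAt W p` (N10 missing input, NOT in print — an
explicit binder, nothing asserted), there is a (the) tame branch `B` for `(f, χ_p, a_p(V))` and every
Selmer dual datum of `E` over the cyclotomic `ℤ_p`-extension is `Λ`-torsion with characteristic power
series `p^k·B(T)`. All other inputs are THEOREMS (§1–§3; `PotMult W p` from the twist). -/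
theorem exists_isTameBranchOf_and_charIdeal_eq_of_mult_twist_pStar (hT : TameBranchRatCharEqAt W p)
    (hp2 : p ≠ 2) (V : WeierstrassCurve ℚ) [V.IsElliptic]
    (hVW : ∃ C : VariableChange ℚ, C • V.quadraticTwist ((((-1 : ℤ) ^ (p / 2) * p : ℤ)) : ℚ) = W)
    (hadd : Addv W p) (hV : Mult V p) {K : ZpExtension ℚ p} {γ : Field.absoluteGaloisGroup ℚ}
    (hK : K.IsCyclotomic) (hγ : K.IsTopGenerator γ) (hcyc : IsCyclotomicVariable p γ)
    (hf : IsNewformOf W f) (hg : IsNewformOf V g) :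
    ∃ B : PowerSeries ℚ_[p],
      IsTameBranchOf f p ((legendreChar p).ringHomComp (algebraMap ℚ_[p] ℂ_[p]))
        (((V.LFunction p : ℤ)) : ℚ_[p]) B ∧
      ∀ D : W.SelmerDualData K γ, D.IsTorsion ∧
        ∃ (G : IwasawaAlgebra p) (k : ℤ), D.charIdeal = Ideal.span {G} ∧
          iwasawaToPowerSeries p G = PowerSeries.C ((p : ℚ_[p]) ^ k) * B := by
  obtain ⟨B, hB, -⟩ := exists_isTameBranchOf_of_mult_twist_pStar hp2 V W hVW hadd hV hf hg
  obtain ⟨hap1, -⟩ := LFunction_eq_or_eq_neg_and_dvd_level_of_mult V hV hg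
  have hαu : ‖(((V.LFunction p : ℤ)) : ℚ_[p])‖ = 1 := by
    rcases hap1 with h | h <;> rw [h] <;> simp
  have hd0 : ((((-1 : ℤ) ^ (p / 2) * p : ℤ)) : ℚ) ≠ 0 := by
    push_cast
    exact mul_ne_zero (pow_ne_zero _ (by norm_num)) (by exact_mod_cast hp.out.ne_zero)
  have hM : PotMult W p := potMult_of_twist_of_mult V W hd0 hVW hV
  exact ⟨B, hB, fun D ↦ isTorsion_and_charIdeal_eq_of_tameBranchRatCharEq_legendre_of_potMult W p
    hT hp2 hadd hM hK hγ hcyc hf hαu hB D⟩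

/-- **JOIN on (G-ord, `e = 2`), every odd `p`.** As above with `V` globally minimal GOOD ORDINARY at
`p` and `α = unitRoot V p`; the `W`-side typing of the row (`PotMult W p ∨ TypeGOrd W p`,
`tameDefect W p = 2`: Kodaira `I₀*`) is taken as binders, `TameBranchRatCharEqAt W p` is the one
non-theorem input. Nothing asserted; nothing booked. -/
theorem exists_isTameBranchOf_and_charIdeal_eq_of_goodOrd_twist_pStar (hT : TameBranchRatCharEqAt W p)
    (hp2 : p ≠ 2) (V : WeierstrassCurve ℚ) [V.IsElliptic] [V.IsGloballyMinimal]
    (hVW : ∃ C : VariableChange ℚ, C • V.quadraticTwist ((((-1 : ℤ) ^ (p / 2) * p : ℤ)) : ℚ) = W)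
    (hadd : Addv W p) (hord : GoodOrd V p) (hloc : PotMult W p ∨ TypeGOrd W p)
    (he : tameDefect W p = 2) {K : ZpExtension ℚ p} {γ : Field.absoluteGaloisGroup ℚ}
    (hK : K.IsCyclotomic) (hγ : K.IsTopGenerator γ) (hcyc : IsCyclotomicVariable p γ)
    (hf : IsNewformOf W f) (hg : IsNewformOf V g) :
    ∃ B : PowerSeries ℚ_[p],
      IsTameBranchOf f p ((legendreChar p).ringHomComp (algebraMap ℚ_[p] ℂ_[p]))
        (unitRoot V p : ℚ_[p]) B ∧
      ∀ D : W.SelmerDualData K γ, D.IsTorsion ∧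
        ∃ (G : IwasawaAlgebra p) (k : ℤ), D.charIdeal = Ideal.span {G} ∧
          iwasawaToPowerSeries p G = PowerSeries.C ((p : ℚ_[p]) ^ k) * B := by
  obtain ⟨B, hB, -⟩ := exists_isTameBranchOf_of_goodOrd_twist_pStar hp2 V W hVW hadd hord hf hg
  obtain ⟨-, hαu, -⟩ := unitRoot_coe_spec (W := V) ((isOrdinaryAt_iff V p).mpr hord)
  exact ⟨B, hB, fun D ↦ isTorsion_and_charIdeal_eq_of_tameBranchRatCharEq_legendre W p hT hp2 hadd
    hloc he hK hγ hcyc hf hαu hB D⟩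

end Join

end Summit.BirchSwinnertonDyer.Rank1Residual.Additive

end
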